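import Summits.BirchSwinnertonDyer.BirchSwinnertonDyer.Theses.SignedLowerHalves
import Summits.BirchSwinnertonDyer.BirchSwinnertonDyer.Theorems.SignedLowerHalvesSprungLowerHalfAtThreeRankCut
import Summits.BirchSwinnertonDyer.BirchSwinnertonDyer.Theorems.PrintX8VSCRankZeroLinkOfPrintX8Contra
import HarnessLib

/-! # K3 `SignedLowerHalves` rev 22/23 — the TURNKEY #5 v5+ glue and the two by-name twins, closed

Route K3 re-drew its X8 corner BY SIGNATURE against `PrintX8VSC` (director-bsd (314)(1); rev 22 eddc6b5d0626, rev 23 0d0b0597c8db).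
This file closes the three K3 items born by that edit which are provable NOW:

* `signedSupersingularOfPrintX8Links_holds` — item stmt-BirchSwinnertonDyer-23863 (glue, auto-crux): rung K3's leaf from cruxes 2/3/4 +
  MC′ + Pub_C + GZK + Link0 + Link1 + the K3 print pack, NO residual — `ChromaticCommonZeros.signedSupersingular_of_lowerHalves_rankCuts`
  (p621820 §2) with the WHOLE X8 corner fed by PrintX8VSC's links (r_an = 0: Link0; r_an = 1: Link1);
* `rankZeroLinkOfPrintX8Contra_holds` — item stmt-BirchSwinnertonDyer-23862 (K3 twin of PrintX8VSC's CLOSED 23744): by name from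
  `PrintX8VSCGlue.rankZeroLinkOfPrintX8Contra_holds` (p675447; the two defs are syntactically identical);
(the Honda aside twin 23868 is closed by the companion file `SignedLowerHalvesInputHondaSystem.lean`).

No summit statement, no crux (19000 / 19001 / 23599 / 23600 / MC′ 23742) and no print fact is proved here; BSD is not proved. -/

set_option autoImplicit false
-- justification: the mandated namespace `Summit.BirchSwinnertonDyer.BirchSwinnertonDyer.Theorems`
-- (single-conjunct summit, Sub = Summit) repeats a segment by design (D-0017).
set_option linter.dupNamespace false

namespace Summit.BirchSwinnertonDyer.BirchSwinnertonDyer.Theorems.SignedLowerHalvesPrintX8Links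

open Literature
open Summit.BirchSwinnertonDyer.BirchSwinnertonDyer.Theses.SignedLowerHalves

/-- KERNEL CERTIFICATE of the new glue: `signedSupersingular_of_lowerHalves_rankCuts` (p621820 §2) with the X8 branch `r_an = 0 ∧ Surj` fed by
Link0 (any image would do; we keep the cut of record so R8 is used verbatim). -/
theorem signedSupersingularOfPrintX8Links_holds :
    Summit.BirchSwinnertonDyer.BirchSwinnertonDyer.Theses.SignedLowerHalves.SignedSupersingularOfPrintX8Links := by
  intro hB1 hB2 hB2' hMC hPubC hGZK' hLink0 hLink1 hPub
  unfold KobayashiLowerHalfSemistable at hB1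
  unfold KobayashiLowerHalfLargeImage at hB2
  unfold KobayashiMainConjectureSmallImage at hB2'
  have hL0 := hLink0 hPubC hGZK' hMC
  have hL1 := hLink1 hPubC hGZK' hMC
  unfold PublishedSignedInputs at hPub
  intro W _ _ p _ hr hcm hp
  obtain ⟨hW, h12, h41, hKim, hA5, h5, h3, hmodP, hmod, hGZK⟩ := hPub
  haveI : Finite W.sha := (hGZK W hr).2
  have hPP := fun h ↦ Literature.NumberTheory.EllipticCurves.Rank1Residual.Typed.missingPPartAt_of_bsdp W p h
  have hLU := fun h ↦
    Literature.NumberTheory.EllipticCurves.Rank1Residual.Typed.lower_and_upper_of_missingPPartAt W p h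
  have toX6 : Literature.NumberTheory.EllipticCurves.Rank1Residual.Typed.MissingPPartAt W p →
      Literature.NumberTheory.EllipticCurves.Rank1Residual.Typed.X6.MissingInputAt W p := fun h ↦
    ⟨fun _ _ _ ↦ (hLU h).1, fun _ ↦ h⟩
  have toX7 : Literature.NumberTheory.EllipticCurves.Rank1Residual.Typed.MissingPPartAt W p →
      Literature.NumberTheory.EllipticCurves.Rank1Residual.Typed.X7.MissingInputAt W p := fun h ↦
    ⟨fun _ _ _ ↦ (hLU h).1, fun _ ↦ h⟩
  have toX8 : Literature.NumberTheory.EllipticCurves.Rank1Residual.Typed.MissingPPartAt W p →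
      Literature.NumberTheory.EllipticCurves.Rank1Residual.Typed.X8.MissingInputAt W p := fun h ↦
    ⟨fun _ _ ↦ (hLU h).1, fun _ ↦ h⟩
  -- corner X8 (used twice: directly, and for the `a_3 = ±3` pairs of corner X7 at `p = 3`)
  have hX8 : Literature.NumberTheory.EllipticCurves.Rank1Residual.ClassX8 W p →
      Literature.NumberTheory.EllipticCurves.Rank1Residual.Typed.X8.MissingInputAt W p := by
    intro hX
    -- THE CHANGE w.r.t. p621820 §2: EVERY X8 pair of the leaf is fed PrintX8VSC's links (r_an = 0: Link0; r_an = 1: Link1) — no R8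
    rcases Nat.le_one_iff_eq_zero_or_eq_one.mp hr with h0 | h1
    · exact toX8 (hL0 W p hX h0)
    · exact toX8 (hL1 W p hX h1)
  refine ⟨fun hX _ ↦ ?_, fun hX ↦ ?_, hX8⟩
  · -- corner X6
    obtain ⟨ε, hlow⟩ := hB1 W p hp hX
    exact toX6 (hPP (Summit.BirchSwinnertonDyer.Rank1Residual.Supersingular.X6.bsdp_of_lowerDivisibility W p
      hW h12 h41 hKim hA5 h5 h3 hmodP hmod hGZK hp hX hr ε hlow))
  · -- corner X7
    by_cases hap : W.frobeniusTrace p = 0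
    · by_cases hs : Literature.NumberTheory.EllipticCurves.Rank1Residual.Surj W p
      · obtain ⟨ε, hlow⟩ := hB2 W p hp hX hcm hap hs
        exact toX7 (hPP (Summit.BirchSwinnertonDyer.Rank1Residual.Supersingular.X7.bsdp_of_lowerDivisibility_of_surj
          W p hW h12 h41 hKim hA5 h5 h3 hmodP hmod hGZK hp hX hap hs hr ε hlow))
      · obtain ⟨ε, hMC7⟩ := hB2' W p hp hX hcm hap hs
        rcases Nat.le_one_iff_eq_zero_or_eq_one.mp hr with h0 | h1
        · exact toX7 (hPP (Summit.BirchSwinnertonDyer.Rank1Residual.Supersingular.bsdp_of_kobayashiMainConjecture_of_analyticRank_eq_zero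
            W p h12 hKim Literature.NumberTheory.EllipticCurves.pollack_exists_plusMinusPAdicLFunction_holds hmodP
            hmod hGZK hp hX.1.1 hap (Literature.NumberTheory.EllipticCurves.Rank1Residual.ClassX7.irr W p hp hX)
            h0 hMC7))
        · exact toX7 (hPP (Summit.BirchSwinnertonDyer.Rank1Residual.Supersingular.X7.bsdp_of_kobayashiMainConjecture_of_corA5_of_analyticRank_eq_one
            W p hA5 hmod hGZK hp hX hap h1 ε hMC7))
    · -- `a_p ≠ 0` at a good supersingular prime forces `p = 3`, `a_3 = ±3`: the pair is in corner X8
      have hp3 : p = 3 := by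
        by_contra h3'
        have hpr : p.Prime := Fact.out
        have h5p : 5 ≤ p := by
          have h2 := hpr.two_le
          have h4 : p ≠ 4 := by intro h4; rw [h4] at hpr; norm_num at hpr
          omega
        exact hap (Summit.BirchSwinnertonDyer.Rank1Residual.Supersingular.ClassX7.frobeniusTrace_eq_zero_of_five_le
          W p h5p hX)
      subst hp3
      have hX' : Literature.NumberTheory.EllipticCurves.Rank1Residual.ClassX8 W 3 := ⟨rfl, hX.1, hap⟩
      obtain ⟨hlow8, hpp8⟩ := hX8 hX'
      exact ⟨fun h0 _ himg ↦ hlow8 h0 himg, fun hc ↦ hpp8 (fun hc' ↦ hc ⟨hc'.1, hp, hc'.2⟩)⟩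

/-- item stmt-BirchSwinnertonDyer-23862 closed by name (K3 twin of PrintX8VSC 23744, p675447). -/
theorem rankZeroLinkOfPrintX8Contra_holds :
    Summit.BirchSwinnertonDyer.BirchSwinnertonDyer.Theses.SignedLowerHalves.RankZeroLinkOfPrintX8Contra :=
  fun hPubC hGZK hMC => Summit.BirchSwinnertonDyer.BirchSwinnertonDyer.Theorems.PrintX8VSCGlue.rankZeroLinkOfPrintX8Contra_holds hPubC hGZK hMC

end Summit.BirchSwinnertonDyer.BirchSwinnertonDyer.Theorems.SignedLowerHalvesPrintX8Links
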